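import Mathlib
import Literature.Analysis.FluidPDE.ClassicalSolution
import Literature.Analysis.FluidPDE.LerayHopf
import Literature.Analysis.FluidPDE.NSWave0
import Literature.Analysis.FluidPDE.NSViscosityRescaling
import Literature.Analysis.FluidPDE.NSLerayHopfABCScaling
import Literature.Analysis.FluidPDE.ClassicalSolutionRescale
import Literature.Analysis.FluidPDE.LerayHopfNSRescale
import Literature.Analysis.FluidPDE.TaoQuantitativeReduction
import Literature.Analysis.FluidPDE.SereginSverak2002PressureLowerBoundProofs
import Summits.NavierStokesRegularity.NavierStokesRegularity.Theses.L3TimeExponentPincer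
import Summits.NavierStokesRegularity.NavierStokesRegularity.Theorems.Target.Negative.NormalForms
import HarnessLib

/-!
# Normal form of crux `L3CascadeJaw` (stmt-NavierStokesRegularity-19499): WLOG `ν = 1`, `T = 1`

Support file for the PARENT crux `L3CascadeJaw` of route `L3TimeExponentPincer` (cell
ns-regularity-ideate, seat ns-pincer-19499-p1).  The clause of the crux — "for a frame solution
`(u, p)` with viscosity `ν` on `[0,T)`, `∫_{T₂}^T ‖u(t)‖_{L³}^q dt < ∞ on a final window" — is
COVARIANT under both symmetries of the frame:

* the viscosity normalisation `v(s, x) = ν⁻¹ u(s/ν, x)` (Tao 2013, footnote 3; tree: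
  `IsClassicalNSSolutionOn.viscosityRescale_set`, `IsLerayHopfOn.viscosityRescale`,
  `hasRapidSpatialDecay_const_smul`), which maps `(ν, T) ↦ (1, νT)` and multiplies the jaw integrand
  by `ν^{-q}` and the window measure by `ν` (`jawClause_of_viscosity_one`);
* Leray's similarity `w(s, y) = √T u(T s, √T y)` at fixed viscosity (tree:
  `IsClassicalNSSolutionOn.nsRescale_holds`, `IsLerayHopfOn.nsRescale_holds`,
  `hasRapidSpatialDecay_nsRescaleData`, and the SCALE INVARIANCE of the critical norm
  `eLpNorm_nsRescale_three`), which maps `(1, T) ↦ (1, 1)` and only rescales time in the jaw integral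
  (`jawClause_one_of_unit`).

Hence **`l3CascadeJaw_iff_unit`**: `L3CascadeJaw` is equivalent to its instance `ν = 1`, `T = 1` —
provers of the parent (and, clause by clause, of the child `EffSatBlowup` and the residual
`SupercriticalSerrinL3`, whose frames are the same) may normalise both parameters, and every
unit-viscosity Literature fact applies without a rescaling detour (time change of variables on windows:
the tree's `setLIntegral_Ioo_comp_const_mul`).

Pattern credit: the same normal form for crux `Target` (stmt-NavierStokesRegularity-1217) is
`Theorems.Target.Negative.NormalForms.target_iff_unit` (cdisprove); this file is its `L3CascadeJaw`
twin and imports its decay helper.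

WHAT THIS IS NOT: not a claim about Navier–Stokes regularity or blow-up; a kernel-checked symmetry
reduction of the crux AS TYPED, landed `--supports … --as helper`.
-/

noncomputable section

namespace Summit.NavierStokesRegularity.NavierStokesRegularity.Theorems.L3TimeExponentPincerJawNormalForm

open MeasureTheory Set Function Filter Topology
open scoped ENNReal NNReal
open Literature.Analysis.FluidPDE
open Summit.NavierStokesRegularity.NavierStokesRegularity.Theses.L3TimeExponentPincer (L3CascadeJaw)
open Summit.NavierStokesRegularity.NavierStokesRegularity.Theorems.Target.Negative
  (hasRapidSpatialDecay_nsRescaleData)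

/-! ## Viscosity normalisation `ν ↦ 1` -/

/-- **The clause at viscosity `1` (all lifespans) gives the clause at every viscosity.**  For a fixed
exponent `q ≥ 0`: if every `ν = 1` frame solution on every `[0,T')` has a final window with
`∫ ‖u‖₃^q < ∞`, then so does every frame solution with viscosity `ν > 0` on `[0,T)` — apply the
hypothesis to `v(s, x) = ν⁻¹ u(s/ν, x)` on `[0, νT)` (classical with viscosity `1`, Leray–Hopf from
`ν⁻¹ u(0)`, rapidly decaying datum) and change variables `s = νt` in the jaw integral
(`‖v(s)‖₃^q = ν^{-q} ‖u(s/ν)‖₃^q`). [cite: Tao2011, footnote 3] -/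
theorem jawClause_of_viscosity_one {q : ℝ} (hq : 0 ≤ q)
    (h1 : ∀ T : ℝ, 0 < T →
      ∀ (u : ℝ → EuclideanSpace ℝ (Fin 3) → EuclideanSpace ℝ (Fin 3)) (p : ℝ → EuclideanSpace ℝ (Fin 3) → ℝ),
        IsClassicalNSSolutionOn (Ico 0 T) 1 0 u p → IsLerayHopfOn T 1 0 (u 0) u →
        HasRapidSpatialDecay (u 0) →
        ∃ T₂ ∈ Ioo 0 T, (∫⁻ t in Ioo T₂ T, eLpNorm (u t) 3 volume ^ q) < ⊤)
    {ν T : ℝ} (hν : 0 < ν) (hT : 0 < T)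
    (u : ℝ → EuclideanSpace ℝ (Fin 3) → EuclideanSpace ℝ (Fin 3)) (p : ℝ → EuclideanSpace ℝ (Fin 3) → ℝ)
    (hcl : IsClassicalNSSolutionOn (Ico 0 T) ν 0 u p) (hLH : IsLerayHopfOn T ν 0 (u 0) u)
    (hdec : HasRapidSpatialDecay (u 0)) :
    ∃ T₂ ∈ Ioo 0 T, (∫⁻ t in Ioo T₂ T, eLpNorm (u t) 3 volume ^ q) < ⊤ := by
  have hν0 : ν ≠ 0 := hν.ne'
  have hνi : 0 < ν⁻¹ := inv_pos.2 hν
  have hνT : 0 < ν * T := mul_pos hν hT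
  set v : ℝ → EuclideanSpace ℝ (Fin 3) → EuclideanSpace ℝ (Fin 3) := timeRescale ν⁻¹ ν⁻¹ u with hv
  set π : ℝ → EuclideanSpace ℝ (Fin 3) → ℝ := timeRescale ν⁻¹ (ν⁻¹ ^ 2) p with hπ
  have hmaps : MapsTo (fun s => ν⁻¹ * s) (Ico 0 (ν * T)) (Ico 0 T) := by
    intro s hs
    refine ⟨mul_nonneg hνi.le hs.1, ?_⟩
    calc ν⁻¹ * s < ν⁻¹ * (ν * T) := mul_lt_mul_of_pos_left hs.2 hνi
      _ = T := by rw [← mul_assoc, inv_mul_cancel₀ hν0, one_mul]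
  -- (1) classical at viscosity 1 on `[0, νT)`
  have hclv : IsClassicalNSSolutionOn (Ico 0 (ν * T)) 1 0 v π := by
    have h := hcl.viscosityRescale_set hν0 hmaps (uniqueDiffOn_Ico 0 (ν * T))
    rwa [timeRescale_zero_force] at h
  -- (2) Leray–Hopf
  have hv0 : ν⁻¹ • u 0 = v 0 := by
    funext x
    simp [hv]
  have hLHv : IsLerayHopfOn (ν * T) 1 0 (v 0) v := by
    have h := hLH.viscosityRescale hνi
    have e1 : T / ν⁻¹ = ν * T := by rw [div_inv_eq_mul, mul_comm]
    rwa [e1, inv_mul_cancel₀ hν0, timeRescale_zero_force, hv0] at h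
  -- (3) decay of the datum
  have hdecv : HasRapidSpatialDecay (v 0) := by
    rw [← hv0]
    exact SereginSverak2002_pressureOneSidedBound.hasRapidSpatialDecay_const_smul
      (hcl.contDiff_velocity ⟨le_rfl, hT⟩) hdec ν⁻¹
  -- (4) the clause for `v` and the change of variables back
  obtain ⟨S₂, hS₂, hfin⟩ := h1 (ν * T) hνT v π hclv hLHv hdecv
  refine ⟨ν⁻¹ * S₂, ⟨mul_pos hνi hS₂.1, ?_⟩, ?_⟩
  · calc ν⁻¹ * S₂ < ν⁻¹ * (ν * T) := mul_lt_mul_of_pos_left hS₂.2 hνi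
      _ = T := by rw [← mul_assoc, inv_mul_cancel₀ hν0, one_mul]
  -- `‖v(s)‖₃^q = ν^{-q} ‖u(ν⁻¹ s)‖₃^q`
  have hslice : ∀ s : ℝ, eLpNorm (v s) 3 volume ^ q =
      ENNReal.ofReal ν⁻¹ ^ q * eLpNorm (u (ν⁻¹ * s)) 3 volume ^ q := by
    intro s
    have e : v s = ν⁻¹ • u (ν⁻¹ * s) := by
      funext x
      simp [hv]
    rw [e, eLpNorm_const_smul, Real.enorm_eq_ofReal hνi.le, ENNReal.mul_rpow_of_nonneg _ _ hq]
  -- `∫_{(S₂, νT)} ‖u(ν⁻¹ s)‖₃^q ds = ν ∫_{(ν⁻¹S₂, T)} ‖u(t)‖₃^q dt`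
  have hcv := setLIntegral_Ioo_comp_const_mul (fun t => eLpNorm (u t) 3 volume ^ q) hνi S₂ (ν * T)
  have e2 : ν⁻¹ * (ν * T) = T := by rw [← mul_assoc, inv_mul_cancel₀ hν0, one_mul]
  rw [e2, inv_inv] at hcv
  -- finiteness
  have hfin' : (∫⁻ s in Ioo S₂ (ν * T), eLpNorm (u (ν⁻¹ * s)) 3 volume ^ q) < ⊤ := by
    have hc : ENNReal.ofReal ν⁻¹ ^ q ≠ 0 := by
      have : ENNReal.ofReal ν⁻¹ ≠ 0 := (ENNReal.ofReal_pos.2 hνi).ne'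
      exact (ENNReal.rpow_pos (pos_iff_ne_zero.2 this) ENNReal.ofReal_ne_top).ne'
    have hct : ENNReal.ofReal ν⁻¹ ^ q ≠ ⊤ := ENNReal.rpow_ne_top_of_nonneg hq ENNReal.ofReal_ne_top
    have heq : (∫⁻ s in Ioo S₂ (ν * T), eLpNorm (v s) 3 volume ^ q) =
        ENNReal.ofReal ν⁻¹ ^ q * ∫⁻ s in Ioo S₂ (ν * T), eLpNorm (u (ν⁻¹ * s)) 3 volume ^ q := by
      rw [← lintegral_const_mul' _ _ hct]
      exact lintegral_congr fun s => hslice s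
    rw [heq] at hfin
    exact lt_top_iff_ne_top.2 fun htop => by
      rw [htop, ENNReal.mul_top hc] at hfin
      exact lt_irrefl _ hfin
  rw [hcv] at hfin'
  exact lt_top_iff_ne_top.2 fun htop => by
    rw [htop, ENNReal.mul_top (by simpa using hν)] at hfin'
    exact lt_irrefl _ hfin'

/-! ## Time normalisation `T ↦ 1` (Leray's similarity at fixed viscosity) -/

/-- **The clause at `ν = 1`, `T = 1` gives the clause at `ν = 1` for every lifespan.**  For a fixed
exponent `q`: apply the hypothesis to `w(s, y) = √T u(T s, √T y)` on `[0,1)` (classical, Leray–Hopf,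
rapidly decaying datum) and use the scale invariance of the critical norm,
`‖w(s)‖₃ = ‖u(Ts)‖₃`, plus the time change `t = Ts`. [cite: Leray1934, §20] -/
theorem jawClause_one_of_unit {q : ℝ}
    (h11 : ∀ (u : ℝ → EuclideanSpace ℝ (Fin 3) → EuclideanSpace ℝ (Fin 3)) (p : ℝ → EuclideanSpace ℝ (Fin 3) → ℝ),
        IsClassicalNSSolutionOn (Ico 0 1) 1 0 u p → IsLerayHopfOn 1 1 0 (u 0) u →
        HasRapidSpatialDecay (u 0) →
        ∃ T₂ ∈ Ioo 0 1, (∫⁻ t in Ioo T₂ 1, eLpNorm (u t) 3 volume ^ q) < ⊤)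
    {T : ℝ} (hT : 0 < T)
    (u : ℝ → EuclideanSpace ℝ (Fin 3) → EuclideanSpace ℝ (Fin 3)) (p : ℝ → EuclideanSpace ℝ (Fin 3) → ℝ)
    (hcl : IsClassicalNSSolutionOn (Ico 0 T) 1 0 u p) (hLH : IsLerayHopfOn T 1 0 (u 0) u)
    (hdec : HasRapidSpatialDecay (u 0)) :
    ∃ T₂ ∈ Ioo 0 T, (∫⁻ t in Ioo T₂ T, eLpNorm (u t) 3 volume ^ q) < ⊤ := by
  set c : ℝ := Real.sqrt T with hc
  have hcpos : 0 < c := Real.sqrt_pos.2 hT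
  have hc2 : c ^ 2 = T := Real.sq_sqrt hT.le
  set w : ℝ → EuclideanSpace ℝ (Fin 3) → EuclideanSpace ℝ (Fin 3) :=
    Literature.Analysis.FluidPDE.nsRescale c u with hw
  set ϖ : ℝ → EuclideanSpace ℝ (Fin 3) → ℝ := nsRescalePressure c p with hϖ
  -- (1) classical on `[0, 1)`
  have hset : ((fun t => c ^ 2 * t) ⁻¹' Ico 0 T) = Ico 0 1 := by
    ext t
    simp only [mem_preimage, mem_Ico, hc2]
    constructor
    · rintro ⟨h0, h1⟩
      exact ⟨nonneg_of_mul_nonneg_right h0 hT, by nlinarith⟩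
    · rintro ⟨h0, h1⟩
      exact ⟨by positivity, by nlinarith⟩
  have hclw : IsClassicalNSSolutionOn (Ico 0 1) 1 0 w ϖ := by
    have h := IsClassicalNSSolutionOn.nsRescale_holds hcl hcpos
    rwa [hset, nsRescaleForce_zero] at h
  -- (2) Leray–Hopf on `[0, 1)`
  have hw0 : nsRescaleData c (u 0) = w 0 := by
    funext x
    simp [hw, nsRescaleData_apply]
  have hLHw : IsLerayHopfOn 1 1 0 (w 0) w := by
    have h := IsLerayHopfOn.nsRescale_holds hLH hcpos
    rwa [hc2, div_self hT.ne', nsRescaleForce_zero, hw0] at h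
  -- (3) decay
  have hdecw : HasRapidSpatialDecay (w 0) := by
    rw [← hw0]
    exact hasRapidSpatialDecay_nsRescaleData (hcl.contDiff_velocity ⟨le_rfl, hT⟩) hdec hcpos
  -- (4) the clause for `w`, and back by `t = T s`
  obtain ⟨S₂, hS₂, hfin⟩ := h11 w ϖ hclw hLHw hdecw
  refine ⟨T * S₂, ⟨mul_pos hT hS₂.1, by nlinarith [hS₂.2]⟩, ?_⟩
  have hslice : ∀ s : ℝ, eLpNorm (w s) 3 volume ^ q = eLpNorm (u (T * s)) 3 volume ^ q := by
    intro s
    rw [hw, eLpNorm_nsRescale_three u hcpos s, hc2]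
  have heq : (∫⁻ s in Ioo S₂ 1, eLpNorm (w s) 3 volume ^ q) =
      ∫⁻ s in Ioo S₂ 1, eLpNorm (u (T * s)) 3 volume ^ q := lintegral_congr fun s => hslice s
  have hcv := setLIntegral_Ioo_comp_const_mul (fun t => eLpNorm (u t) 3 volume ^ q) hT S₂ 1
  rw [mul_one] at hcv
  rw [heq, hcv] at hfin
  exact lt_top_iff_ne_top.2 fun htop => by
    rw [htop, ENNReal.mul_top (by simpa using hT)] at hfin
    exact lt_irrefl _ hfin

/-! ## The normal form -/

/-- **Normal form of `L3CascadeJaw`: WLOG `ν = 1` and `T = 1`.**  The crux is equivalent to its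
instance at unit viscosity and unit lifespan: for every `q ∈ (4,5)`, every classical solution of the
unforced system with `ν = 1` on `ℝ³ × [0,1)` that is Leray–Hopf on `[0,1)` from a rapidly decaying
datum has `∫_{T₂}^1 ‖u(t)‖₃^q dt < ∞` for some `T₂ ∈ (0,1)`. [cite: Tao2011, footnote 3]
[cite: Leray1934, §20] -/
theorem l3CascadeJaw_iff_unit :
    L3CascadeJaw ↔
      ∀ q : ℝ, 4 < q → q < 5 →
        ∀ (u : ℝ → EuclideanSpace ℝ (Fin 3) → EuclideanSpace ℝ (Fin 3)) (p : ℝ → EuclideanSpace ℝ (Fin 3) → ℝ),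
          IsClassicalNSSolutionOn (Ico 0 1) 1 0 u p → IsLerayHopfOn 1 1 0 (u 0) u →
          HasRapidSpatialDecay (u 0) →
          ∃ T₂ ∈ Ioo 0 1, (∫⁻ t in Ioo T₂ 1, eLpNorm (u t) 3 volume ^ q) < ⊤ := by
  constructor
  · intro h q hq4 hq5
    exact h q hq4 hq5 1 1 one_pos one_pos
  · intro h11 q hq4 hq5 ν T hν hT u p hcl hLH hdec
    exact jawClause_of_viscosity_one (q := q) (by linarith)
      (fun T' hT' => jawClause_one_of_unit (h11 q hq4 hq5) hT') hν hT u p hcl hLH hdec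

/-- **WLOG `ν = 1`** (viscosity-only normal form, all lifespans kept): convenient when a
unit-viscosity Literature fact is to be applied on a general window. [cite: Tao2011, footnote 3] -/
theorem l3CascadeJaw_iff_viscosity_one :
    L3CascadeJaw ↔
      ∀ q : ℝ, 4 < q → q < 5 → ∀ T : ℝ, 0 < T →
        ∀ (u : ℝ → EuclideanSpace ℝ (Fin 3) → EuclideanSpace ℝ (Fin 3)) (p : ℝ → EuclideanSpace ℝ (Fin 3) → ℝ),
          IsClassicalNSSolutionOn (Ico 0 T) 1 0 u p → IsLerayHopfOn T 1 0 (u 0) u →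
          HasRapidSpatialDecay (u 0) →
          ∃ T₂ ∈ Ioo 0 T, (∫⁻ t in Ioo T₂ T, eLpNorm (u t) 3 volume ^ q) < ⊤ := by
  constructor
  · intro h q hq4 hq5 T hT
    exact h q hq4 hq5 1 T one_pos hT
  · intro h1 q hq4 hq5 ν T hν hT u p hcl hLH hdec
    exact jawClause_of_viscosity_one (q := q) (by linarith) (h1 q hq4 hq5) hν hT u p hcl hLH hdec

end Summit.NavierStokesRegularity.NavierStokesRegularity.Theorems.L3TimeExponentPincerJawNormalForm

end
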